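import Summits.QuantumFields.YangMills.Theorems.ColdStartUniversalityLatticeLangevinOscillationCarre
import Summits.QuantumFields.YangMills.Theorems.ColdStartUniversalityLatticeLangevinBakryEmeryGradientBound
import Summits.QuantumFields.YangMills.Theorems.ColdStartUniversalityLatticeLangevinGradientBoundOfRep
import Summits.QuantumFields.YangMills.Theorems.ColdStartUniversalityLatticeLangevinWilsonReversibleMeasurable
import Summits.QuantumFields.YangMills.Theorems.ColdStartUniversalityUniformColdStartMixingFixedCutoffDynamicVarianceLoopWindow
import HarnessLib

/-!
# Route `ColdStartUniversality` (fixed-cut-off package, Bakry–Émery side, GRADIENT half): SUP-NORM (EVERY-START) EXPONENTIAL MIXING of the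
# `SU(2)` lattice Langevin (SZZ) dynamics in the window `|β'| < 1/12`, VOLUME-FREE for volume-averaged observables

Helper file (seat `ym-line-csu-p1`, g29; `--supports stmt-QuantumFields-24809`).  Composition of the gradient-bound package with the
oscillation–carré du champ lemma (`oscillation_le_of_carre_le`) and the invariance of `μ_(β')`:
* ★★★ `wilson_pointwise_mixing_of_carre_uniform` — for `C⁵` `f` with `Γ^A(f) ≤ σ²` on the group, every realising Markov kernel family `κ`,
  every `t ≥ 0` and EVERY start `x`:  `|κ_t(f∘coords)(x) − μ_(β')(f∘coords)| ≤ π·√#E·e^(−(1−12|β'|)t)·σ`;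
* ★★ `wilson_pointwise_mixing_of_bounded_uniform` — for `C⁵` `f` with `|f∘coords| ≤ M`, `t > 0`, `s ≥ 0`, every start `x`:
  `|κ_(t+s)(f∘coords)(x) − μ_(β')(f∘coords)| ≤ π·√#E·e^(−(1−12|β'|)s)·√(2(1−12|β'|)/(e^(2(1−12|β'|)t) − 1))·M` (sup-norm mixing in time
  `O(log #E)` for bounded data, no densities, no initial-law assumption);
* ★★★ `wilson_actionDensity_pointwise_mixing_uniform` / `wilson_solution_actionDensity_pointwise_mixing_uniform` — for the action density
  `S_W/#𝒫` the constant is VOLUME-FREE: `|E[S_W(U_t^x)]/#𝒫 − μ_(β')(S_W/#𝒫)| ≤ 8π·e^(−(1−12|β'|)t)` for every strong solution from every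
  deterministic start `x`, every `L`, every `t`;
* ★★ `actionDensity_pointwiseMixing_fixedCutoff_window` — the same at the route's cut-offs inside the window `γε_K > 6` (rate `1 − 6/(γε_K)`).
THEOREMS ONLY, no definition, no sorry.  [cite: BakryGentilLedoux2014, Thm 3.3.18 + §4.7; ShenZhuZhu2022 §4].
HONEST FRAMING: fixed cut-off; "uniform" = in the volume `L`, the start `x` and the time, at a FIXED coupling `|β'| < 1/12`; along the route's
scaling `β'_K = (γε_K)⁻¹/2 → ∞` the window `γε_K > 6` is eventually left, so nothing here is `K`-uniform; `UniformColdStartMixing`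
(stmt-24809, aside) is NOT restated or weakened here, and the Yang–Mills mass gap is NOT proved.
-/

set_option autoImplicit false

noncomputable section

namespace Summit.QuantumFields.YangMills.Theorems.ColdStartUniversality

open MeasureTheory ProbabilityTheory Matrix Complex Finset Filter Set Metric
open scoped ComplexConjugate BigOperators Matrix NNReal ENNReal Topology
open Literature.Probability.Process Literature.MathematicalPhysics.QuantumFieldTheory
open Literature.MathematicalPhysics.QuantumFieldTheory.Balaban1983to89
open Literature.MathematicalPhysics.QuantumLattice (fundamentalRep fundamentalLatticeRep continuous_fundamentalRep fundamentalRep_apply)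

variable {L : ℕ} [NeZero L]

/-! ## §1. Lipschitz data: every-start exponential convergence -/

/-- ★★★ **Every-start exponential mixing for Lipschitz data, uniform in the volume.**  At `|β'| < 1/12`, for every `C⁵` `f` with
`Γ^A(f) ≤ σ²` on the group, every Markov kernel family `κ` realising the SZZ solutions, every `t ≥ 0` and EVERY configuration `x`:
`|κ_t(f∘coords)(x) − ∫ f∘coords dμ_(β')| ≤ π·√#E·e^(−(1−12|β'|)t)·σ` (`#E` = number of links).  Proof: gradient bound
(`wilson_lipschitz_contraction_uniform`) + oscillation lemma (`oscillation_le_of_carre_le`) + invariance of `μ_(β')`.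
[cite: BakryGentilLedoux2014, Thm 3.3.18; ShenZhuZhu2022 §4] -/
theorem wilson_pointwise_mixing_of_carre_uniform (L : ℕ) [NeZero L] (β' : ℝ) (hβ : |β'| < 1 / 12)
    (κ : ℝ≥0 → Kernel (GaugeConfig 3 L (Matrix.specialUnitaryGroup (Fin 2) ℂ))
      (GaugeConfig 3 L (Matrix.specialUnitaryGroup (Fin 2) ℂ))) [∀ t, IsMarkovKernel (κ t)]
    (hreal : ∀ (t : ℝ≥0) (x : GaugeConfig 3 L (Matrix.specialUnitaryGroup (Fin 2) ℂ))
        (Ω : Type) [MeasurableSpace Ω] (P : Measure Ω) [IsProbabilityMeasure P]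
        (W : ℝ≥0 → Ω → (Edge 3 L × NoiseIdx 2 → ℝ)) (hW : IsFlatBrownian W P)
        (U : ℝ≥0 → Ω → GaugeConfig 3 L (Matrix.specialUnitaryGroup (Fin 2) ℂ)),
        (∀ ω, U 0 ω = x) →
        (latticeLangevinDynamics (fundamentalLatticeRep 2) β').IsSolution (fundamentalRep (Fin 2))
          hW.natFiltration P W U →
        κ t x = P.map (U t))
    {f : (Edge 3 L × Fin 2 × Fin 2 × Bool → ℝ) → ℝ} (hf : ContDiff ℝ 5 f) {σ : ℝ} (hσ : 0 ≤ σ) (t : ℝ≥0) :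
    let coords : GaugeConfig 3 L (Matrix.specialUnitaryGroup (Fin 2) ℂ) → (Edge 3 L × Fin 2 × Fin 2 × Bool → ℝ) :=
      fun V q => (fun z : ℂ => if q.2.2.2 then z.im else z.re)
        ((fundamentalRep (Fin 2) (V q.1) : Matrix (Fin 2) (Fin 2) ℂ) q.2.1 q.2.2.1)
    let A : GaugeConfig 3 L (Matrix.specialUnitaryGroup (Fin 2) ℂ) → (Edge 3 L × Fin 2 × Fin 2 × Bool) →
        (Edge 3 L × Fin 2 × Fin 2 × Bool) → ℝ := fun V i j =>
      ∑ n : Edge 3 L × NoiseIdx 2,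
        (if n.1 = i.1 then (fun z : ℂ => if i.2.2.2 then z.im else z.re)
          ((latticeLangevinDynamics (fundamentalLatticeRep 2) β').noise
            (matrixConfig (fundamentalRep (Fin 2)) V) i.1 n.2 i.2.1 i.2.2.1) else 0) *
        (if n.1 = j.1 then (fun z : ℂ => if j.2.2.2 then z.im else z.re)
          ((latticeLangevinDynamics (fundamentalLatticeRep 2) β').noise
            (matrixConfig (fundamentalRep (Fin 2)) V) j.1 n.2 j.2.1 j.2.2.1) else 0)
    (∀ y, (∑ i : Edge 3 L × Fin 2 × Fin 2 × Bool, ∑ j : Edge 3 L × Fin 2 × Fin 2 × Bool, fderiv ℝ f (coords y) (Pi.single i 1) * fderiv ℝ f (coords y) (Pi.single j 1) * A y i j) ≤ σ ^ 2) →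
    ∀ x, |∫ y, f (coords y) ∂(κ t x) - ∫ y, f (coords y) ∂(wilsonMeasure (d := 3) (L := L) (fundamentalRep (Fin 2)) β')| ≤
      Real.pi * Real.sqrt (Fintype.card (Edge 3 L)) * (Real.exp (-((1 - 12 * |β'|) * (t : ℝ))) * σ) := by
  intro coords A hΓ x
  classical
  haveI := secondCountableTopology_su2
  haveI := borelSpace_config L
  haveI : IsProbabilityMeasure (wilsonMeasure (d := 3) (L := L) (fundamentalRep (Fin 2)) β') :=
    isProbabilityMeasure_wilsonMeasure (d := 3) (L := L) (fundamentalRep (Fin 2)) (continuous_fundamentalRep (Fin 2)) β'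
  have hco : Continuous coords := continuous_coords (L := L)
  -- the representative of `κ_t F` and its carré du champ bound
  obtain ⟨g, hg, -, hgrep, hbound⟩ := wilson_lipschitz_contraction_uniform L β' hβ κ hreal hf t hΓ
  have hgrep' : ∀ x : (GaugeConfig 3 L (Matrix.specialUnitaryGroup (Fin 2) ℂ)), ∫ y, f (coords y) ∂(κ t x) = g (coords x) := fun x => hgrep x
  have hσt : 0 ≤ Real.exp (-((1 - 12 * |β'|) * (t : ℝ))) * σ := mul_nonneg (Real.exp_pos _).le hσ
  have he : Real.exp (-(2 * (1 - 12 * |β'|) * (t : ℝ))) * σ ^ 2 = (Real.exp (-((1 - 12 * |β'|) * (t : ℝ))) * σ) ^ 2 := by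
    rw [mul_pow, sq (Real.exp (-((1 - 12 * |β'|) * (t : ℝ)))), ← Real.exp_add]
    congr 1; congr 1; ring
  have hΓg : ∀ y, (∑ i : Edge 3 L × Fin 2 × Fin 2 × Bool, ∑ j : Edge 3 L × Fin 2 × Fin 2 × Bool, fderiv ℝ g (coords y) (Pi.single i 1) * fderiv ℝ g (coords y) (Pi.single j 1) * A y i j) ≤ (Real.exp (-((1 - 12 * |β'|) * (t : ℝ))) * σ) ^ 2 := fun y => by
    have h := hbound y
    rw [he] at h
    exact h
  have hosc := oscillation_le_of_carre_le L β' (hg.of_le (by norm_num)) hσt hΓg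
  -- invariance of `μ_(β')`
  have cF : Continuous fun y : (GaugeConfig 3 L (Matrix.specialUnitaryGroup (Fin 2) ℂ)) => f (coords y) := hf.continuous.comp hco
  obtain ⟨C, hC⟩ : ∃ C, ∀ y : (GaugeConfig 3 L (Matrix.specialUnitaryGroup (Fin 2) ℂ)), |f (coords y)| ≤ C := by
    obtain ⟨C, hC⟩ := isCompact_univ.exists_bound_of_continuousOn cF.continuousOn
    exact ⟨C, fun y => by simpa [Real.norm_eq_abs] using hC y (Set.mem_univ y)⟩
  have hinv : ∫ x', (∫ y, f (coords y) ∂(κ t x')) ∂(wilsonMeasure (d := 3) (L := L) (fundamentalRep (Fin 2)) β') = ∫ y, f (coords y) ∂(wilsonMeasure (d := 3) (L := L) (fundamentalRep (Fin 2)) β') :=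
    integral_transitionKernel_integral_eq_wilson β' κ hreal t cF.measurable ⟨C, hC⟩
  have hmean : ∫ x', g (coords x') ∂(wilsonMeasure (d := 3) (L := L) (fundamentalRep (Fin 2)) β') = ∫ y, f (coords y) ∂(wilsonMeasure (d := 3) (L := L) (fundamentalRep (Fin 2)) β') :=
    (integral_congr_ae (ae_of_all _ fun x' => (hgrep' x').symm)).trans hinv
  have hI : Integrable (fun x' : (GaugeConfig 3 L (Matrix.specialUnitaryGroup (Fin 2) ℂ)) => g (coords x')) (wilsonMeasure (d := 3) (L := L) (fundamentalRep (Fin 2)) β') :=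
    integrable_of_continuous_of_compactSpace (hg.continuous.comp hco) _
  have hdiff : g (coords x) - ∫ y, f (coords y) ∂(wilsonMeasure (d := 3) (L := L) (fundamentalRep (Fin 2)) β') = ∫ x', (g (coords x) - g (coords x')) ∂(wilsonMeasure (d := 3) (L := L) (fundamentalRep (Fin 2)) β') := by
    rw [integral_sub (integrable_const _) hI, integral_const, smul_eq_mul, probReal_univ, one_mul, hmean]
  rw [hgrep' x, hdiff]
  have hn := norm_integral_le_of_norm_le_const (μ := (wilsonMeasure (d := 3) (L := L) (fundamentalRep (Fin 2)) β')) (f := fun x' : (GaugeConfig 3 L (Matrix.specialUnitaryGroup (Fin 2) ℂ)) => g (coords x) - g (coords x'))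
    (C := Real.pi * Real.sqrt (Fintype.card (Edge 3 L)) * (Real.exp (-((1 - 12 * |β'|) * (t : ℝ))) * σ))
    (ae_of_all _ fun x' => by rw [Real.norm_eq_abs]; exact hosc x' x)
  rw [probReal_univ, mul_one, Real.norm_eq_abs] at hn
  exact hn

/-! ## §2. Bounded data: smoothing, then decay — sup-norm mixing in time `O(log #E)` -/

/-- ★★ **Every-start exponential mixing for bounded data.**  At `|β'| < 1/12`, for every `C⁵` `f` with `|f∘coords| ≤ M` on the group,
every realising Markov kernel family `κ`, every `t > 0`, `s ≥ 0` and EVERY configuration `x`: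
`|κ_(t+s)(f∘coords)(x) − ∫ f∘coords dμ_(β')| ≤ π·√#E·e^(−(1−12|β'|)s)·√(2(1−12|β'|)/(e^(2(1−12|β'|)t) − 1))·M` — reverse local Poincaré
smoothing on `[0,t]` (`wilson_lipschitz_decay_of_bounded_uniform`), gradient-bound decay on `[t,t+s]`, oscillation lemma, invariance.
Consequently the sup-norm mixing time of bounded smooth cylinder observables is `O((1−12|β'|)⁻¹ log(#E·M/δ))` from every start.
[cite: BakryGentilLedoux2014, Thm 3.3.18 + Thm 4.7.2; ShenZhuZhu2022 §4] -/
theorem wilson_pointwise_mixing_of_bounded_uniform (L : ℕ) [NeZero L] (β' : ℝ) (hβ : |β'| < 1 / 12)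
    (κ : ℝ≥0 → Kernel (GaugeConfig 3 L (Matrix.specialUnitaryGroup (Fin 2) ℂ))
      (GaugeConfig 3 L (Matrix.specialUnitaryGroup (Fin 2) ℂ))) [∀ t, IsMarkovKernel (κ t)]
    (hreal : ∀ (t : ℝ≥0) (x : GaugeConfig 3 L (Matrix.specialUnitaryGroup (Fin 2) ℂ))
        (Ω : Type) [MeasurableSpace Ω] (P : Measure Ω) [IsProbabilityMeasure P]
        (W : ℝ≥0 → Ω → (Edge 3 L × NoiseIdx 2 → ℝ)) (hW : IsFlatBrownian W P)
        (U : ℝ≥0 → Ω → GaugeConfig 3 L (Matrix.specialUnitaryGroup (Fin 2) ℂ)),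
        (∀ ω, U 0 ω = x) →
        (latticeLangevinDynamics (fundamentalLatticeRep 2) β').IsSolution (fundamentalRep (Fin 2))
          hW.natFiltration P W U →
        κ t x = P.map (U t))
    {f : (Edge 3 L × Fin 2 × Fin 2 × Bool → ℝ) → ℝ} (hf : ContDiff ℝ 5 f) {M : ℝ} {t : ℝ≥0} (ht : 0 < (t : ℝ)) (s : ℝ≥0) :
    let coords : GaugeConfig 3 L (Matrix.specialUnitaryGroup (Fin 2) ℂ) → (Edge 3 L × Fin 2 × Fin 2 × Bool → ℝ) :=
      fun V q => (fun z : ℂ => if q.2.2.2 then z.im else z.re)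
        ((fundamentalRep (Fin 2) (V q.1) : Matrix (Fin 2) (Fin 2) ℂ) q.2.1 q.2.2.1)
    (∀ y, |f (coords y)| ≤ M) →
    ∀ x, |∫ y, f (coords y) ∂(κ (t + s) x) - ∫ y, f (coords y) ∂(wilsonMeasure (d := 3) (L := L) (fundamentalRep (Fin 2)) β')| ≤
      Real.pi * Real.sqrt (Fintype.card (Edge 3 L)) * (Real.exp (-((1 - 12 * |β'|) * (s : ℝ))) * Real.sqrt ((2 * (1 - 12 * |β'|)) / (Real.exp (2 * (1 - 12 * |β'|) * (t : ℝ)) - 1)) * M) := by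
  intro coords hM x
  classical
  haveI := secondCountableTopology_su2
  haveI := borelSpace_config L
  haveI : IsProbabilityMeasure (wilsonMeasure (d := 3) (L := L) (fundamentalRep (Fin 2)) β') :=
    isProbabilityMeasure_wilsonMeasure (d := 3) (L := L) (fundamentalRep (Fin 2)) (continuous_fundamentalRep (Fin 2)) β'
  have hco : Continuous coords := continuous_coords (L := L)
  set A : GaugeConfig 3 L (Matrix.specialUnitaryGroup (Fin 2) ℂ) → (Edge 3 L × Fin 2 × Fin 2 × Bool) →
        (Edge 3 L × Fin 2 × Fin 2 × Bool) → ℝ := fun V i j =>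
      ∑ n : Edge 3 L × NoiseIdx 2,
        (if n.1 = i.1 then (fun z : ℂ => if i.2.2.2 then z.im else z.re)
          ((latticeLangevinDynamics (fundamentalLatticeRep 2) β').noise
            (matrixConfig (fundamentalRep (Fin 2)) V) i.1 n.2 i.2.1 i.2.2.1) else 0) *
        (if n.1 = j.1 then (fun z : ℂ => if j.2.2.2 then z.im else z.re)
          ((latticeLangevinDynamics (fundamentalLatticeRep 2) β').noise
            (matrixConfig (fundamentalRep (Fin 2)) V) j.1 n.2 j.2.1 j.2.2.1) else 0) with hA_def
  have hM0 : 0 ≤ M := (abs_nonneg _).trans (hM x)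
  have hρ : 0 < (1 - 12 * |β'|) := by linarith
  have hden : 0 < Real.exp (2 * (1 - 12 * |β'|) * (t : ℝ)) - 1 := by
    have : 1 < Real.exp (2 * (1 - 12 * |β'|) * (t : ℝ)) := Real.one_lt_exp_iff.2 (mul_pos (mul_pos two_pos hρ) ht)
    linarith
  have hq : 0 ≤ (2 * (1 - 12 * |β'|)) / (Real.exp (2 * (1 - 12 * |β'|) * (t : ℝ)) - 1) := div_nonneg (by linarith) hden.le
  -- the representative of `κ_(t+s) F` and its carré du champ bound
  obtain ⟨g, hg, -, hgrep⟩ := transitionKernel_preserves_dynkinClass L β' κ hreal (t + s) (hf.of_le (by norm_num))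
  have hgrep' : ∀ x : (GaugeConfig 3 L (Matrix.specialUnitaryGroup (Fin 2) ℂ)), ∫ y, f (coords y) ∂(κ (t + s) x) = g (coords x) := fun x => hgrep x
  have hK := wilson_lipschitz_decay_of_bounded_uniform L β' hβ κ hreal hf ht s (hg.of_le (by norm_num)) hM hgrep'
  have hσ0 : 0 ≤ Real.exp (-((1 - 12 * |β'|) * (s : ℝ))) * Real.sqrt ((2 * (1 - 12 * |β'|)) / (Real.exp (2 * (1 - 12 * |β'|) * (t : ℝ)) - 1)) * M := mul_nonneg (mul_nonneg (Real.exp_pos _).le (Real.sqrt_nonneg _)) hM0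
  have he : Real.exp (-(2 * (1 - 12 * |β'|) * (s : ℝ))) * ((2 * (1 - 12 * |β'|)) / (Real.exp (2 * (1 - 12 * |β'|) * (t : ℝ)) - 1) * M ^ 2) =
      (Real.exp (-((1 - 12 * |β'|) * (s : ℝ))) * Real.sqrt ((2 * (1 - 12 * |β'|)) / (Real.exp (2 * (1 - 12 * |β'|) * (t : ℝ)) - 1)) * M) ^ 2 := by
    rw [mul_pow, mul_pow, Real.sq_sqrt hq, sq (Real.exp (-((1 - 12 * |β'|) * (s : ℝ)))), ← Real.exp_add]
    have h2 : -((1 - 12 * |β'|) * (s : ℝ)) + -((1 - 12 * |β'|) * (s : ℝ)) = -(2 * (1 - 12 * |β'|) * (s : ℝ)) := by ring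
    rw [h2]; ring
  have hΓg : ∀ y, (∑ i : Edge 3 L × Fin 2 × Fin 2 × Bool, ∑ j : Edge 3 L × Fin 2 × Fin 2 × Bool, fderiv ℝ g (coords y) (Pi.single i 1) * fderiv ℝ g (coords y) (Pi.single j 1) * A y i j) ≤ (Real.exp (-((1 - 12 * |β'|) * (s : ℝ))) * Real.sqrt ((2 * (1 - 12 * |β'|)) / (Real.exp (2 * (1 - 12 * |β'|) * (t : ℝ)) - 1)) * M) ^ 2 := fun y => by
    have h := hK y
    rw [he] at h
    exact h
  have hosc := oscillation_le_of_carre_le L β' (hg.of_le (by norm_num)) hσ0 hΓg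
  -- invariance of `μ_(β')`
  have cF : Continuous fun y : (GaugeConfig 3 L (Matrix.specialUnitaryGroup (Fin 2) ℂ)) => f (coords y) := hf.continuous.comp hco
  obtain ⟨C, hC⟩ : ∃ C, ∀ y : (GaugeConfig 3 L (Matrix.specialUnitaryGroup (Fin 2) ℂ)), |f (coords y)| ≤ C := ⟨M, hM⟩
  have hinv : ∫ x', (∫ y, f (coords y) ∂(κ (t + s) x')) ∂(wilsonMeasure (d := 3) (L := L) (fundamentalRep (Fin 2)) β') = ∫ y, f (coords y) ∂(wilsonMeasure (d := 3) (L := L) (fundamentalRep (Fin 2)) β') :=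
    integral_transitionKernel_integral_eq_wilson β' κ hreal (t + s) cF.measurable ⟨C, hC⟩
  have hmean : ∫ x', g (coords x') ∂(wilsonMeasure (d := 3) (L := L) (fundamentalRep (Fin 2)) β') = ∫ y, f (coords y) ∂(wilsonMeasure (d := 3) (L := L) (fundamentalRep (Fin 2)) β') :=
    (integral_congr_ae (ae_of_all _ fun x' => (hgrep' x').symm)).trans hinv
  have hI : Integrable (fun x' : (GaugeConfig 3 L (Matrix.specialUnitaryGroup (Fin 2) ℂ)) => g (coords x')) (wilsonMeasure (d := 3) (L := L) (fundamentalRep (Fin 2)) β') :=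
    integrable_of_continuous_of_compactSpace (hg.continuous.comp hco) _
  have hdiff : g (coords x) - ∫ y, f (coords y) ∂(wilsonMeasure (d := 3) (L := L) (fundamentalRep (Fin 2)) β') = ∫ x', (g (coords x) - g (coords x')) ∂(wilsonMeasure (d := 3) (L := L) (fundamentalRep (Fin 2)) β') := by
    rw [integral_sub (integrable_const _) hI, integral_const, smul_eq_mul, probReal_univ, one_mul, hmean]
  rw [hgrep' x, hdiff]
  have hn := norm_integral_le_of_norm_le_const (μ := (wilsonMeasure (d := 3) (L := L) (fundamentalRep (Fin 2)) β')) (f := fun x' : (GaugeConfig 3 L (Matrix.specialUnitaryGroup (Fin 2) ℂ)) => g (coords x) - g (coords x'))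
    (C := Real.pi * Real.sqrt (Fintype.card (Edge 3 L)) * (Real.exp (-((1 - 12 * |β'|) * (s : ℝ))) * Real.sqrt ((2 * (1 - 12 * |β'|)) / (Real.exp (2 * (1 - 12 * |β'|) * (t : ℝ)) - 1)) * M))
    (ae_of_all _ fun x' => by rw [Real.norm_eq_abs]; exact hosc x' x)
  rw [probReal_univ, mul_one, Real.norm_eq_abs] at hn
  exact hn

/-! ## §3. The action density: a volume-free constant -/

/-- ★★★ **Every-start mixing of the action density, volume-free.**  At `|β'| < 1/12`, for every torus size `L`, every realising Markov
kernel family `κ`, every `t ≥ 0` and EVERY configuration `x`:  `|κ_t(S_W/#𝒫)(x) − ∫ S_W/#𝒫 dμ_(β')| ≤ 8π·e^(−(1−12|β'|)t)`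
(`Γ^A(S_W/#𝒫) ≤ 64/#𝒫` and `#E = #𝒫 = 3L³`, so `π√#E·σ = 8π`). [cite: BakryGentilLedoux2014, Thm 3.3.18; ShenZhuZhu2022 §4] -/
theorem wilson_actionDensity_pointwise_mixing_uniform (L : ℕ) [NeZero L] (β' : ℝ) (hβ : |β'| < 1 / 12)
    (κ : ℝ≥0 → Kernel (GaugeConfig 3 L (Matrix.specialUnitaryGroup (Fin 2) ℂ))
      (GaugeConfig 3 L (Matrix.specialUnitaryGroup (Fin 2) ℂ))) [∀ t, IsMarkovKernel (κ t)]
    (hreal : ∀ (t : ℝ≥0) (x : GaugeConfig 3 L (Matrix.specialUnitaryGroup (Fin 2) ℂ))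
        (Ω : Type) [MeasurableSpace Ω] (P : Measure Ω) [IsProbabilityMeasure P]
        (W : ℝ≥0 → Ω → (Edge 3 L × NoiseIdx 2 → ℝ)) (hW : IsFlatBrownian W P)
        (U : ℝ≥0 → Ω → GaugeConfig 3 L (Matrix.specialUnitaryGroup (Fin 2) ℂ)),
        (∀ ω, U 0 ω = x) →
        (latticeLangevinDynamics (fundamentalLatticeRep 2) β').IsSolution (fundamentalRep (Fin 2))
          hW.natFiltration P W U →
        κ t x = P.map (U t))
    (t : ℝ≥0) (x : (GaugeConfig 3 L (Matrix.specialUnitaryGroup (Fin 2) ℂ))) :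
    |∫ y, wilsonAction (fundamentalRep (Fin 2)) y / (Fintype.card (Plaquette 3 L) : ℝ) ∂(κ t x) - ∫ y, wilsonAction (fundamentalRep (Fin 2)) y / (Fintype.card (Plaquette 3 L) : ℝ) ∂(wilsonMeasure (d := 3) (L := L) (fundamentalRep (Fin 2)) β')| ≤ 8 * Real.pi * Real.exp (-((1 - 12 * |β'|) * (t : ℝ))) := by
  classical
  haveI := secondCountableTopology_su2
  haveI := borelSpace_config L
  haveI : IsProbabilityMeasure (wilsonMeasure (d := 3) (L := L) (fundamentalRep (Fin 2)) β') :=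
    isProbabilityMeasure_wilsonMeasure (d := 3) (L := L) (fundamentalRep (Fin 2)) (continuous_fundamentalRep (Fin 2)) β'
  set nP : ℝ := (Fintype.card (Plaquette 3 L) : ℝ) with hnP
  have hnPpos : 0 < nP := card_plaquette_three_pos L
  have hsq : Real.sqrt nP ≠ 0 := (Real.sqrt_pos.2 hnPpos).ne'
  set b : ℝ := nP⁻¹ with hb
  set co : (GaugeConfig 3 L (Matrix.specialUnitaryGroup (Fin 2) ℂ)) → (Edge 3 L × Fin 2 × Fin 2 × Bool → ℝ) := (fun (V : GaugeConfig 3 L (Matrix.specialUnitaryGroup (Fin 2) ℂ)) (q : Edge 3 L × Fin (fundamentalLatticeRep 2).N × Fin (fundamentalLatticeRep 2).N × Bool) => (fun z : ℂ => if q.2.2.2 then z.im else z.re) ((fundamentalRep (Fin 2) (V q.1) : Matrix (Fin 2) (Fin 2) ℂ) q.2.1 q.2.2.1)) with hco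
  set fp : (Edge 3 L × Fin 2 × Fin 2 × Bool → ℝ) → ℝ := (fun y : (Edge 3 L × Fin 2 × Fin 2 × Bool → ℝ) => b * ∑ p : Plaquette 3 L, (rootedLoop (fun (ee : Edge 3 L) (i j : Fin 2) => ((y (ee, i, j, false) : ℝ) : ℂ) + ((y (ee, i, j, true) : ℝ) : ℂ) * Complex.I) (p.1, p.2.1.1) p.2.1.2 false).trace.re) with hfp
  have hfpC : ContDiff ℝ 5 fp := contDiff_psiHat (d := 3) (L := L) (N := 2) (n := 5) b
  have hval : ∀ V, fp (co V) = 2 - wilsonAction (fundamentalRep (Fin 2)) V / nP := by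
    intro V
    have h : fp (co V) = 2 * b * nP - b * wilsonAction (fundamentalRep (Fin 2)) V := psiHat_coords_eq_wilsonAction b V
    rw [h, div_eq_mul_inv, hb]
    have : 2 * nP⁻¹ * nP = 2 := by rw [mul_assoc, inv_mul_cancel₀ hnPpos.ne', mul_one]
    rw [this]; ring
  -- `Γ^A(fp) ≤ 64 b² #𝒫 = (8/√#𝒫)²`
  have hσ : 0 ≤ 8 / Real.sqrt nP := div_nonneg (by norm_num) (Real.sqrt_nonneg _)
  have hc : 64 * b ^ 2 * (Fintype.card (Plaquette 3 L) : ℝ) = (8 / Real.sqrt nP) ^ 2 := by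
    rw [← hnP, div_pow, Real.sq_sqrt hnPpos.le, hb]
    field_simp
    norm_num
  have hΓ := wilson_plaquette_carre_le L β' b
  have h := wilson_pointwise_mixing_of_carre_uniform L β' hβ κ hreal hfpC hσ t (fun y => by
    have h1 := hΓ y
    rw [hc] at h1
    exact h1) x
  -- `S_W/#𝒫 = 2 − fp∘coords` under both probability measures
  have cY : Continuous fun V : (GaugeConfig 3 L (Matrix.specialUnitaryGroup (Fin 2) ℂ)) => fp (co V) := hfpC.continuous.comp (continuous_coords (L := L))
  have hX : ∀ y : (GaugeConfig 3 L (Matrix.specialUnitaryGroup (Fin 2) ℂ)), wilsonAction (fundamentalRep (Fin 2)) y / nP = 2 - fp (co y) := fun y => by rw [hval]; ring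
  have hrw : ∀ (ν : Measure (GaugeConfig 3 L (Matrix.specialUnitaryGroup (Fin 2) ℂ))) [IsProbabilityMeasure ν], ∫ y, wilsonAction (fundamentalRep (Fin 2)) y / nP ∂ν = 2 - ∫ y, fp (co y) ∂ν := by
    intro ν _
    rw [show (fun y : (GaugeConfig 3 L (Matrix.specialUnitaryGroup (Fin 2) ℂ)) => wilsonAction (fundamentalRep (Fin 2)) y / nP) = fun y => (2 : ℝ) - fp (co y) from funext hX,
      integral_sub (integrable_const _) (integrable_of_continuous_of_compactSpace cY ν), integral_const]
    simp only [probReal_univ, smul_eq_mul, one_mul]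
  rw [hrw (κ t x), hrw (wilsonMeasure (d := 3) (L := L) (fundamentalRep (Fin 2)) β'), show ((2 : ℝ) - ∫ y, fp (co y) ∂(κ t x)) - (2 - ∫ y, fp (co y) ∂(wilsonMeasure (d := 3) (L := L) (fundamentalRep (Fin 2)) β')) =
    -(∫ y, fp (co y) ∂(κ t x) - ∫ y, fp (co y) ∂(wilsonMeasure (d := 3) (L := L) (fundamentalRep (Fin 2)) β')) by ring, abs_neg]
  have hE : Real.sqrt (Fintype.card (Edge 3 L) : ℝ) = Real.sqrt nP := by
    rw [hnP, card_edge_eq_three_mul_card_site, card_site_three, card_plaquette_three]; push_cast; ring_nf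
  have hfin : Real.pi * Real.sqrt (Fintype.card (Edge 3 L) : ℝ) * (Real.exp (-((1 - 12 * |β'|) * (t : ℝ))) * (8 / Real.sqrt nP)) = 8 * Real.pi * Real.exp (-((1 - 12 * |β'|) * (t : ℝ))) := by
    rw [hE]
    field_simp
  rw [hfin] at h
  exact h

/-- ★★★ **Every-start mixing of the action density along EVERY SZZ solution, volume-free.**  At `|β'| < 1/12`: for every torus size `L`,
every filtered probability space carrying a flat Brownian driver, every strong solution `U` of the SZZ Langevin SDE from a deterministic
start `U_0 ≡ x₀` (e.g. the COLD start `x₀ = 1`) and every `t ≥ 0`:  `|E[S_W(U_t)]/#𝒫 − ∫ S_W/#𝒫 dμ_(β')| ≤ 8π·e^(−(1−12|β'|)t)`.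
So the expected action density along the cold-start evolution is within `δ` of its `μ_(β')`-mean after lattice time
`(1−12|β'|)⁻¹·log(8π/δ)`, uniformly in `L` — at FIXED `|β'| < 1/12` (not along the route's scaling `β'_K → ∞`).
[cite: BakryGentilLedoux2014, Thm 3.3.18; ShenZhuZhu2022 §4] -/
theorem wilson_solution_actionDensity_pointwise_mixing_uniform (L : ℕ) [NeZero L] (β' : ℝ) (hβ : |β'| < 1 / 12) (t : ℝ≥0) (x₀ : (GaugeConfig 3 L (Matrix.specialUnitaryGroup (Fin 2) ℂ)))
    (Ω : Type) [MeasurableSpace Ω] (P : Measure Ω) [IsProbabilityMeasure P]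
    (W : ℝ≥0 → Ω → (Edge 3 L × NoiseIdx 2 → ℝ)) (hW : IsFlatBrownian W P)
    (U : ℝ≥0 → Ω → (GaugeConfig 3 L (Matrix.specialUnitaryGroup (Fin 2) ℂ))) (hU0 : ∀ ω, U 0 ω = x₀)
    (hU : (latticeLangevinDynamics (fundamentalLatticeRep 2) β').IsSolution (fundamentalRep (Fin 2)) hW.natFiltration P W U) :
    |∫ ω, wilsonAction (fundamentalRep (Fin 2)) (U t ω) / (Fintype.card (Plaquette 3 L) : ℝ) ∂P - ∫ y, wilsonAction (fundamentalRep (Fin 2)) y / (Fintype.card (Plaquette 3 L) : ℝ) ∂(wilsonMeasure (d := 3) (L := L) (fundamentalRep (Fin 2)) β')| ≤ 8 * Real.pi * Real.exp (-((1 - 12 * |β'|) * (t : ℝ))) := by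
  classical
  haveI := secondCountableTopology_su2
  haveI := borelSpace_config L
  obtain ⟨κ, hκ, -, hreal⟩ := exists_transitionKernel L β'
  haveI := hκ
  have h := wilson_actionDensity_pointwise_mixing_uniform L β' hβ κ hreal t x₀
  have hlaw : κ t x₀ = P.map (U t) := hreal t x₀ Ω P W hW U hU0 hU
  have hmU : Measurable (U t) := (hU.adapted t).mono (hW.natFiltration.le t) le_rfl
  have hSm : Measurable fun y : (GaugeConfig 3 L (Matrix.specialUnitaryGroup (Fin 2) ℂ)) => wilsonAction (fundamentalRep (Fin 2)) y / (Fintype.card (Plaquette 3 L) : ℝ) :=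
    (measurable_wilsonAction (d := 3) (L := L) (fundamentalRep (Fin 2)) (continuous_fundamentalRep (Fin 2))).div_const _
  have e1 : ∫ y, wilsonAction (fundamentalRep (Fin 2)) y / (Fintype.card (Plaquette 3 L) : ℝ) ∂(κ t x₀) = ∫ ω, wilsonAction (fundamentalRep (Fin 2)) (U t ω) / (Fintype.card (Plaquette 3 L) : ℝ) ∂P := by
    rw [hlaw, integral_map hmU.aemeasurable hSm.aestronglyMeasurable]
  rw [← e1]
  exact h

/-- ★★ **Every-start mixing of the action density at the route's cut-offs, inside the window `γε_K > 6`.**  For every cut-off `K` with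
`6 < γε_K`, every strong solution `U` of the SZZ SDE at `β'_K = (γε_K)⁻¹/2` on the `K`-th lattice from a deterministic start and every
lattice time `t`:  `|E[S_W(U_t)]/(3L_K³) − ∫ S_W/(3L_K³) dμ_K| ≤ 8π·e^(−(1 − 6/(γε_K))t)`.  (Window-bound: as `ε_K → 0` at fixed `γ` the
hypothesis `6 < γε_K` eventually fails — this is NOT a `K`-uniform statement.) [cite: BakryGentilLedoux2014, Thm 3.3.18] -/
theorem actionDensity_pointwiseMixing_fixedCutoff_window (F : T3ContinuumYM3Torus.T3Family) (γ : ℝ) (K : ℕ) (hK : 6 < γ * (F.P K).eps)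
    (t : ℝ≥0) (x₀ : GaugeConfig 3 ((F.P K).sitesPerDir 0) (Matrix.specialUnitaryGroup (Fin 2) ℂ))
    (Ω : Type) [MeasurableSpace Ω] (P : Measure Ω) [IsProbabilityMeasure P]
    (W : ℝ≥0 → Ω → (Edge 3 ((F.P K).sitesPerDir 0) × NoiseIdx 2 → ℝ)) (hW : IsFlatBrownian W P)
    (U : ℝ≥0 → Ω → GaugeConfig 3 ((F.P K).sitesPerDir 0) (Matrix.specialUnitaryGroup (Fin 2) ℂ)) (hU0 : ∀ ω, U 0 ω = x₀)
    (hU : (latticeLangevinDynamics (fundamentalLatticeRep 2) ((γ * (F.P K).eps)⁻¹ / 2)).IsSolution (fundamentalRep (Fin 2)) hW.natFiltration P W U) :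
    |∫ ω, wilsonAction (fundamentalRep (Fin 2)) (U t ω) / (3 * ((((F.P K).sitesPerDir 0) : ℕ) : ℝ) ^ 3) ∂P -
        ∫ y, wilsonAction (fundamentalRep (Fin 2)) y / (3 * ((((F.P K).sitesPerDir 0) : ℕ) : ℝ) ^ 3)
          ∂(wilsonMeasure (d := 3) (L := (F.P K).sitesPerDir 0) (fundamentalRep (Fin 2)) ((γ * (F.P K).eps)⁻¹ / 2))| ≤
      8 * Real.pi * Real.exp (-((1 - 6 / (γ * (F.P K).eps)) * (t : ℝ))) := by
  obtain ⟨hβ, hrate⟩ := window_coupling_bounds F γ K hK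
  have h := wilson_solution_actionDensity_pointwise_mixing_uniform ((F.P K).sitesPerDir 0) ((γ * (F.P K).eps)⁻¹ / 2) hβ t x₀ Ω P W hW U hU0 hU
  rw [(card_site_plaquette_fixedCutoff F K).2, hrate] at h
  exact h

end Summit.QuantumFields.YangMills.Theorems.ColdStartUniversality
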